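import Literature.MathematicalPhysics.QuantumFieldTheory.Balaban1983to89.B9SectCLatticeCalc

/-!
# `Balaban1983to89.B9SectCLatticeCurl` — the 2-form (plaquette) level of the abstract lattice calculus: `𝔇` of a
# product of SUMS of first-order pairs, the CROSS-TERM EXCHANGE, and the cut-model `hΛ` SHAPE
# `𝔇(D′D + W) = Lm₁·Dv + Lm₀` as a THEOREM in any dimension (D2 of the census, second leaf) — OURS

CITATION HEADER (LEAF RULE: no quotation in this file; pointers BY NAME only).  The published setting is the one
quoted verbatim in the headers of `…B9SectCDiff` (the commutator formula for covariant derivatives and the sentence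
on the cutoff commutators of the vector operator, Balaban, *Commun. Math. Phys.* **99** (1985) 389–434, §C) and of
`…B9SectCDiffCutModel` (the cut-model packaging, whose field `hΛ : X.dΛ = Lm₁ * Dv + Lm₀` is the SHAPE proved
here); the plaquette derivative of the printed vector operator enters only through its SUPPORT PATTERN (which bond a
row reads, at which position); this file adds nothing from print.  Tree inputs, by name: `B9SectCDiff.{tdef,
tdef_def, tdef_mul, tdef_add}`; `B9SectCLatticeCalc.{IsCarried, IsCarried.exchange, IsCarried.tdef_eq_zero,
IsCarried.transpose, IsCarried.diagonal_mul, IsCarried.mul_diagonal, isCarried_diagonal, ThE, ThE_eq, tdef_fwd,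
tdef_bwd, tdef_bwd_fwd, hA_shape, tdef_parts}`; for the sanity instances of §7 only:
`B9SectCDiffCutModelToy4.{ι, Sh, Sh_apply, fd, Th, Xi, Xi_eq}` and `B9SectCLatticeCalc.{nxt, nxt_eq_of_succ,
ThE_toy}`; Mathlib's `Matrix.fromRows`, `Matrix.fromCols`, `Matrix.fromCols_mul_fromRows`, `Matrix.diagonal`,
`Matrix.diagonal_mul`, `Matrix.sum_mul`, `Matrix.mul_sum`, `Matrix.sum_apply`, `Fintype.sum_prod_type`,
`Finset.sum_comm`, `Finset.sum_ite_eq'`, `Finset.sum_add_distrib`, `Finset.sum_sub_distrib`.  The only import is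
`…B9SectCLatticeCalc`.

WHAT THIS MODULE DOES (census `SectC-inst-census.md` §7, item (E″); claim SECTC-LATTICE-CURL).  `…B9SectCLatticeCalc`
proved the scalar level of the calculus (`𝔇(∂)`, `𝔇(∂*)`, the `hA` and `hM` shapes) and LOCATED the obstruction for
the vector operator's `hΛ` (its §5): a plaquette row of the 2-form derivative has target parts at DIFFERENT
positions, and the `k ≠ l` cross terms of `𝔇(D′D)` are bond-to-bond hops with FIRST-difference coefficients, so a
one-sided form with a second-order remainder does not come from one row.  This file resolves the obstruction
ALGEBRAICALLY, by re-reading those cross terms as (first difference) × (`h`-free two-step DIFFERENCE tables):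
* §1 **TOOLS.**  `𝔇` of a finite sum (`tdef_sum`); the weighted adjoint `diagonal w′·Kᵀ·diagonal w` of a table
  carried by `(ρ, κ)` is carried by `(κ, ρ)` (`isCarried_wadjoint`) — the support facts of any lattice
  co-derivative `D′` follow from those of `D`.
* §2 **PAIRS.**  Setting: bonds `b` (positions `xb : b → E`; the 1-form carrier), plaquettes `P` (base position
  `sp`), a finite PAIR INDEX `K` (on the lattice: the directions — the plaquette `{μ, ν}` at `x` contributes the pair
  "`∇_μA_ν`" with index `μ` and the pair "`−∇_νA_μ`" with index `ν`), target maps `tb : K → P → E` (`tb_k p =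
  sp p + e_k`); `D = Σ_k ∂_k` with `∂_k = T_k − J_k : Matrix P b ℝ`, the target part `T_k` carried by `(tb_k, xb)`
  (entries: signed `η`-weighted transporter components, zero where a plaquette has no pair `k`), the source part
  `J_k` carried by `(sp, xb)`; `D′ = Σ_k ∂′_k`, `∂′_k = T′_k − J′_k : Matrix b P ℝ` carried the other way.  **PAIR
  RULE** (`tdef_pair_mul`; `k = l` is `tdef_bwd_fwd`): with `Θ_k(h) = ThE sp tb_k h = diagonal (h ∘ tb_k − h ∘ sp)`,
  `𝔇(∂′_k∂_l) = (T′_kΘ_k + J′_kΘ_l)·∂_l + (J′_kΘ_lJ_l − T′_kΘ_lT_l)`; summed, `tdef_pairs_mul`.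
* §3 **THE CROSS-TERM EXCHANGE** (`cross_exchange`) — the one new move.  DIRECTION DEVICE: a family
  `θ : K → E → ℝ` of functions on positions with `hθ : θ_l (sp p) = h (tb_l p) − h (sp p)` for ALL `l, p` (on the
  lattice `θ_l(x) = h(x + e_l) − h(x)`, defined at every position — this globality is what lets a first difference
  taken at a plaquette be re-read at a bond).  Then `Θ_l(h) = diagonal (θ_l ∘ sp)` (`ThE_eq_of_dir`), and passing
  this multiplication operator through `J′_k` (carried `(xb, sp)`) and `T′_k` (carried `(xb, tb_k)`) by the exchange
  rule gives, for EVERY `(k, l)` including `k = l`,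
  `J′_kΘ_l(h)J_l − T′_kΘ_l(h)T_l = diagonal (θ_l ∘ xb)·(J′_kJ_l − T′_kT_l) + T′_k·Θ_k(θ_l)·T_l`,
  where `Θ_k(θ_l) = diagonal (θ_l ∘ tb_k − θ_l ∘ sp)` is a SECOND difference of `h` (the difference in direction `k`
  of the difference in direction `l`).  Summed: `tdef_pairs_mul_exchanged` (three double sums).
* §4 **PACKAGING = THE `hΛ` SHAPE** (`hΛ_shape`).  With the `h`-FREE stacked derivative `Dv = fromRows Dv₂ Hv` on the
  carrier `(K × P) ⊕ (K × K × b)` — `Dv₂((l, p), ·) = ∂_l(p, ·)` (first covariant differences of the 1-form) and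
  `Hv((k, l, a′), ·) = H_kl(a′, ·)`, `H_kl = J′_kJ_l − T′_kT_l` (TWO-STEP TABLES) — the coefficient `Lm₁ = fromCols
  LmD LmH` (`LmD(a, (l, p)) = Σ_k (T′_kΘ_k + J′_kΘ_l)(a, p)`, `LmH(a, (k, l, a′)) = [a′ = a]·θ_l(xb a)`: FIRST
  differences of `h` times `h`-free entries) and the remainder `Lm₀ = Σ_kΣ_l T′_k·Θ_k(θ_l)·T_l` (SECOND differences
  times `h`-free entries): **`𝔇(D′D + W) = Lm₁·Dv + Lm₀`** for every position-diagonal `W` (`𝔇(W) = 0`), exact,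
  every `h` with `hθ`, every dimension, every entry table with the stated supports (`LmD_mul_Dv₂`, `LmH_mul_Hv`,
  `hΛ_shape`; `hΛ_shape'` carries an arbitrary further term `N` as the named summand `𝔇(N)` of the remainder).
  §4b: if the further term is a finite sum of parts `N_j` carried by `(τ_j, xb)` (every finite-range `h`-free
  perturbation decomposes so, by relative position), `tdef_parts` puts it in the same form with first-difference
  coefficient `LmN` and the `h`-free rows `Nv = (N_j)_j` (`LmN_mul_Nv`, `hΛ_shape_parts`:
  `𝔇(D′D + W + Σ_j N_j) = [LmD ∣ LmH ∣ LmN]·[Dv₂ ; Hv ; Nv] + Lm₀`).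
* §5 **SHARED CARRIER** (`shared_carrier`): the cut model's `hΛ` and `hM` share ONE `Dv`; two one-sided forms over
  different derivative blocks are one-sided forms over `fromRows D₁ D₂` with zero-padded coefficients, so §4's `Dv`
  and the `Dv = (∂·T′_μ)_μ` of `B9SectCLatticeCalc.hM_shape` combine.
* §6 **ONE PAIR** (`am₀_exchange`, `hA_shape_exchanged`): the case `K = Unit` rewrites the `hA` remainder of
  `B9SectCLatticeCalc.hA_shape`, `Am₀ = J′Θ_hJ − T′Θ_hT = diagonal (θ ∘ xs)·(J′J − T′T) + T′·Θ_θ·T` — the precise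
  form of the remark in that file's header §3: `Am₀` is of second-difference type EXACTLY up to a first difference
  times the `h`-free defect table `J′J − T′T`.
* §7 **SANITY INSTANCES.**  (a) The toy line of `…Toy4`: Toy4's second-order remainder exchanged,
  `Ξ_h = diagonal (fd h)·(1 − SᵀS) + Sᵀ·Θ_(fd h)·S` (`Xi_exchange`; `1 − SᵀS` = the indicator of the sites without
  predecessor, `Θ_(fd h) = diagonal (fd (fd h))`).  (b) ONE PLAQUETTE IN `d = 2` (`plaquette_hΛ`): `E = ℤ × ℤ`,
  four bonds, two pairs with target positions `e₀ ≠ e₁` and ARBITRARY transporter entries `r₀, r₁`, `D′ = Dᵀ`,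
  `W = 0` — the hypotheses of `hΛ_shape` are jointly satisfiable in exactly the configuration located as the
  obstruction, for every `h`.

WHAT THE TWO-STEP TABLES ARE (informal lattice reading, `T′_k = c·T_kᵀ`, `J′_k = c·J_kᵀ`, orthogonal transporter
components, matched `η`-weights; recorded for the estimate files, not claimed as theorems here).  For `k ≠ l`,
`(H_kl A)(y, l) = −cη⁻²·[A(y, k) − 𝒰·A(y − e_k + e_l, k)]` with `𝒰` the transport along the FIXED two-bond path
`y ← y − e_k ← y − e_k + e_l` (no holonomy): an `h`-free FIRST covariant difference of the component `A_k` along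
`e_l − e_k`, written into the `l`-slots — controlled by gradient bounds exactly like the rows `∂_l` of `Dv₂`, though
it is not itself a row of the printed one-transporter derivative.  For `k = l`, `H_kk = J′_kJ_k − T′_kT_k` is the
UNITARITY / WEIGHT DEFECT of pair `k`: on the bonds `(y, λ)`, `λ ≠ k`, it is `cη⁻²·([plaquette {k, λ} at y present]
− RᵀR·[plaquette {k, λ} at y − e_k present])` — ZERO in the bulk of a periodic lattice with orthogonal `R` and
matched weights, the (signed) indicator of the boundary bonds under Dirichlet deletions, and `1 − SᵀS` on the toy
line (§7a).  So, away from boundary defects, `Dv` consists of first covariant differences only, `Lm₁` of first and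
`Lm₀` of second differences of `h` — the continuum shadow being `[curl*curl, h]A = (∇h) × curl A + [(∇h) div A −
(∇h·∇)A] + [(A·∇)∇h − A Δh]`: the first bracket is `LmD·Dv₂`, the second `LmH·Hv`, the third `Lm₀`.  (The TRIVIAL
split `𝔇(Λ) = −Σ_j diagonal(first difference_j)·Λ_j` by relative-position parts, `tdef_parts`, also has the one-sided
form, with `Lm₀ = 0`; it is useless for `D′D` because its rows `Λ_j` are bare second-order parts, not differences —
the content of §4 is that `Dv` is made of DIFFERENCES.  For a perturbation `N` whose smallness sits in its entries,
the parts split of §4b is the adequate one.)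

HONEST CAVEATS.  (1) IDENTITIES ONLY: no norms, no `OpZon` / `Realizes` classes, no order bookkeeping in `M⁻¹` —
that `Lm₁` is of first and `Lm₀` of second order, and which gradient bound controls `Dv·G`, is the business of the
estimate files (census §7 lists it as the next item of D2).  (2) The `H_kk`-rows of `Dv` are first-order objects
only where the unitarity / weight defect vanishes (bulk, orthogonal transporters, matched weights); at boundary
deletions they are `η⁻²`-size indicator tables with a first-difference coefficient — harmless only if `h` is
locally constant there; the identity holds regardless, the ORDER claim does not.  (3) The direction device `hθ` asks
for GLOBAL pulled-back differences `θ_l` (one function on positions per pair index); on a lattice with `tb_l = sp +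
e_l` they exist trivially (`θ_l = h(· + e_l) − h`), on a carrier where two plaquettes with the same base position
had different `l`-targets they would not.  (4) Normalisations: the split `Lm₁·Dv` is not unique (`LmH·Hv` is
invariant under `LmH ↦ LmH·c`, `Hv ↦ c⁻¹·Hv`; §5 pads by zero blocks; `B9SectCLatticeCalc.toy_hM_shape` already
exhibited two valid `hM` splits) — the estimate side fixes the normalisation it wants.  (5) The carrier of §4,
`(K × P) ⊕ (K × K × b)` (`⊕ (I × b)` in §4b), is not the carrier `Δ × b` of `B9SectCLatticeCalc.hM_shape`; one
`CutModel.Dv` is obtained by §5.  (6) Value = the algebraic half of the cut-model field `hΛ` for lattice vector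
operators of the form `D′D + (position-diagonal) + (carried finite-range parts)` in general dimension — located
bookkeeping, NOT summit progress; the cut model's estimate fields are untouched.  Every declaration carries a
docstring + `[folklore]` tag; no `sorry`; no `instance`; no `HarnessLib` fact; standard axioms only.
-/

namespace Literature.MathematicalPhysics.QuantumFieldTheory.Balaban1983to89.B9SectCLatticeCurl

open Finset
open B9SectCDiff (tdef tdef_def tdef_mul tdef_add)
open B9SectCLatticeCalc (IsCarried isCarried_diagonal ThE ThE_apply ThE_eq tdef_fwd tdef_bwd tdef_bwd_fwd
  hA_shape tdef_parts)

noncomputable section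

/-! ## §1 Tools: `𝔇` of a finite sum; weighted adjoints of carried tables -/

section Tools

variable {u₁ u₂ v₁ v₂ ι : Type*} [Fintype u₂] [Fintype v₁]

/-- `𝔇` is additive over finite sums (both slots summed in parallel):
`𝔇(Σ_k S_k ∣ Σ_k T_k) = Σ_k 𝔇(S_k ∣ T_k)`. [folklore] -/
theorem tdef_sum (XU : Matrix u₁ u₂ ℝ) (XV : Matrix v₁ v₂ ℝ) (s : Finset ι) (S : ι → Matrix u₁ v₁ ℝ)
    (T : ι → Matrix u₂ v₂ ℝ) :
    tdef XU XV (∑ k ∈ s, S k) (∑ k ∈ s, T k) = ∑ k ∈ s, tdef XU XV (S k) (T k) := by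
  simp only [tdef_def, Matrix.mul_sum, Matrix.sum_mul, Finset.sum_sub_distrib]

end Tools

section Adjoint

variable {E u v : Type*} [Fintype u] [Fintype v] [DecidableEq u] [DecidableEq v]
variable {ρ : u → E} {κ : v → E} {K : Matrix u v ℝ}

/-- the WEIGHTED ADJOINT `diagonal w′·Kᵀ·diagonal w` of a table carried by `(ρ, κ)` is carried by `(κ, ρ)`
(a lattice divergence is such a weighted transpose of the gradient, so the four support facts of `∂*` / `D′`
follow from the four of `∂` / `D`). [folklore] -/
theorem isCarried_wadjoint (hK : IsCarried ρ κ K) (w' : v → ℝ) (w : u → ℝ) :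
    IsCarried κ ρ (Matrix.diagonal w' * K.transpose * Matrix.diagonal w) :=
  (hK.transpose.diagonal_mul w').mul_diagonal w

end Adjoint

/-! ## §2 Pairs: `𝔇` of the product of two first-order pairs with different target maps -/

section Pairs

variable {E b P K : Type*} [Fintype b] [Fintype P] [DecidableEq b] [DecidableEq P]
variable {xb : b → E} {sp : P → E} {tb : K → P → E}
variable {T J : K → Matrix P b ℝ} {T' J' : K → Matrix b P ℝ}

/-- **PAIR RULE** (the `k ≠ l` generalisation of `B9SectCLatticeCalc.tdef_bwd_fwd`): for pairs
`∂_l = T_l − J_l` (`T_l` carried by `(tb_l, xb)`, `J_l` by `(sp, xb)`) and `∂′_k = T′_k − J′_k` (carried the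
other way), with `Θ_k = diagonal (h ∘ tb_k − h ∘ sp)`:
`𝔇(∂′_k∂_l) = (T′_kΘ_k + J′_kΘ_l)·∂_l + (J′_kΘ_lJ_l − T′_kΘ_lT_l)`. [folklore] -/
theorem tdef_pair_mul (hT : ∀ k, IsCarried (tb k) xb (T k)) (hJ : ∀ k, IsCarried sp xb (J k))
    (hT' : ∀ k, IsCarried xb (tb k) (T' k)) (hJ' : ∀ k, IsCarried xb sp (J' k)) (h : E → ℝ) (k l : K) :
    tdef (Matrix.diagonal (h ∘ xb)) (Matrix.diagonal (h ∘ xb)) ((T' k - J' k) * (T l - J l))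
        ((T' k - J' k) * (T l - J l)) =
      (T' k * ThE sp (tb k) h + J' k * ThE sp (tb l) h) * (T l - J l) +
        (J' k * ThE sp (tb l) h * J l - T' k * ThE sp (tb l) h * T l) := by
  rw [tdef_mul (Matrix.diagonal (h ∘ xb)) (Matrix.diagonal (h ∘ sp)) (Matrix.diagonal (h ∘ xb)),
    tdef_bwd (hT' k) (hJ' k), tdef_fwd (hT l) (hJ l)]
  simp only [Matrix.mul_sub, Matrix.sub_mul, Matrix.add_mul, Matrix.mul_neg, Matrix.mul_assoc]
  abel

variable [Fintype K]

/-- **PARTS FORM**: for `D = Σ_l ∂_l`, `D′ = Σ_k ∂′_k`,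
`𝔇(D′D) = Σ_k Σ_l [(T′_kΘ_k + J′_kΘ_l)·∂_l + (J′_kΘ_lJ_l − T′_kΘ_lT_l)]`. [folklore] -/
theorem tdef_pairs_mul (hT : ∀ k, IsCarried (tb k) xb (T k)) (hJ : ∀ k, IsCarried sp xb (J k))
    (hT' : ∀ k, IsCarried xb (tb k) (T' k)) (hJ' : ∀ k, IsCarried xb sp (J' k)) (h : E → ℝ) :
    tdef (Matrix.diagonal (h ∘ xb)) (Matrix.diagonal (h ∘ xb)) ((∑ k, (T' k - J' k)) * ∑ l, (T l - J l))
        ((∑ k, (T' k - J' k)) * ∑ l, (T l - J l)) =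
      ∑ k, ∑ l, ((T' k * ThE sp (tb k) h + J' k * ThE sp (tb l) h) * (T l - J l) +
        (J' k * ThE sp (tb l) h * J l - T' k * ThE sp (tb l) h * T l)) := by
  rw [Matrix.sum_mul]
  simp_rw [Matrix.mul_sum]
  rw [tdef_sum]
  refine Finset.sum_congr rfl fun k _ => ?_
  rw [tdef_sum]
  refine Finset.sum_congr rfl fun l _ => ?_
  exact tdef_pair_mul hT hJ hT' hJ' h k l

/-! ## §3 The cross-term exchange under the direction device -/

omit [Fintype P] [Fintype K] in
/-- under the direction device `hθ` (`θ_l (sp p) = h (tb_l p) − h (sp p)`: the pulled-back difference of `h`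
in "direction" `l`), `Θ_l(h) = diagonal (θ_l ∘ sp)`. [folklore] -/
theorem ThE_eq_of_dir {θs : K → E → ℝ} {h : E → ℝ} {l : K} (hθ : ∀ p, θs l (sp p) = h (tb l p) - h (sp p)) :
    ThE sp (tb l) h = Matrix.diagonal (θs l ∘ sp) := by
  unfold ThE; congr 1; funext p; exact (hθ p).symm

omit [Fintype K] in
/-- **THE CROSS-TERM EXCHANGE**: under `hθ`,
`J′_kΘ_lJ_l − T′_kΘ_lT_l = diagonal (θ_l ∘ xb)·(J′_kJ_l − T′_kT_l) + T′_k·Θ_k(θ_l)·T_l` — a FIRST difference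
times the `h`-free two-step table `H_kl = J′_kJ_l − T′_kT_l`, plus a SECOND difference `Θ_k(θ_l) =
diagonal (θ_l ∘ tb_k − θ_l ∘ sp)` between `h`-free tables.  (Valid for every `(k, l)` including `k = l`.)
[folklore] -/
theorem cross_exchange {θs : K → E → ℝ} {h : E → ℝ} {k l : K} (hT' : IsCarried xb (tb k) (T' k))
    (hJ' : IsCarried xb sp (J' k)) (hθ : ∀ p, θs l (sp p) = h (tb l p) - h (sp p)) :
    J' k * ThE sp (tb l) h * J l - T' k * ThE sp (tb l) h * T l =
      Matrix.diagonal (θs l ∘ xb) * (J' k * J l - T' k * T l) + T' k * ThE sp (tb k) (θs l) * T l := by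
  have e1 : Matrix.diagonal (θs l ∘ xb) * (J' k * J l) = J' k * (Matrix.diagonal (θs l ∘ sp) * J l) := by
    rw [← Matrix.mul_assoc, hJ'.exchange, Matrix.mul_assoc]
  have e2 : Matrix.diagonal (θs l ∘ xb) * (T' k * T l) = T' k * (Matrix.diagonal (θs l ∘ tb k) * T l) := by
    rw [← Matrix.mul_assoc, hT'.exchange, Matrix.mul_assoc]
  rw [ThE_eq_of_dir hθ, ThE_eq]
  simp only [Matrix.mul_sub, Matrix.sub_mul, Matrix.mul_assoc, e1, e2]
  abel

/-- **THE EXCHANGED IDENTITY** (three sums): under `hθ` for every `l`,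
`𝔇(D′D) = Σ_kΣ_l (T′_kΘ_k + J′_kΘ_l)·∂_l + Σ_kΣ_l diagonal (θ_l ∘ xb)·H_kl + Σ_kΣ_l T′_k·Θ_k(θ_l)·T_l`
— coefficient (first differences) × `h`-free first-order pairs, coefficient (first differences) × `h`-free
two-step tables, and a remainder of SECOND differences × `h`-free tables; from the supports and `hθ` alone.
[folklore] -/
theorem tdef_pairs_mul_exchanged {θs : K → E → ℝ} {h : E → ℝ} (hT : ∀ k, IsCarried (tb k) xb (T k))
    (hJ : ∀ k, IsCarried sp xb (J k)) (hT' : ∀ k, IsCarried xb (tb k) (T' k))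
    (hJ' : ∀ k, IsCarried xb sp (J' k)) (hθ : ∀ l p, θs l (sp p) = h (tb l p) - h (sp p)) :
    tdef (Matrix.diagonal (h ∘ xb)) (Matrix.diagonal (h ∘ xb)) ((∑ k, (T' k - J' k)) * ∑ l, (T l - J l))
        ((∑ k, (T' k - J' k)) * ∑ l, (T l - J l)) =
      ∑ k, ∑ l, (T' k * ThE sp (tb k) h + J' k * ThE sp (tb l) h) * (T l - J l) +
        ∑ k, ∑ l, Matrix.diagonal (θs l ∘ xb) * (J' k * J l - T' k * T l) +
          ∑ k, ∑ l, T' k * ThE sp (tb k) (θs l) * T l := by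
  have ce : ∀ k l, J' k * ThE sp (tb l) h * J l - T' k * ThE sp (tb l) h * T l =
      Matrix.diagonal (θs l ∘ xb) * (J' k * J l - T' k * T l) + T' k * ThE sp (tb k) (θs l) * T l :=
    fun k l => cross_exchange (hT' k) (hJ' k) (hθ l)
  rw [tdef_pairs_mul hT hJ hT' hJ' h]
  simp only [ce, Finset.sum_add_distrib]
  abel

/-! ## §4 Packaging: `𝔇(D′D + W) = Lm₁·Dv + Lm₀` with `h`-free `Dv = Dv₂ ⊕ Hv` -/

/-- the stacked pair derivatives `Dv₂ : Matrix (K × P) b ℝ`, `Dv₂((l, p), ·) = ∂_l(p, ·)` — `h`-free.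
OURS (typing). [folklore] -/
def Dv₂ (T J : K → Matrix P b ℝ) : Matrix (K × P) b ℝ := Matrix.of fun q c => (T q.1 - J q.1) q.2 c

/-- the stacked two-step tables `Hv : Matrix (K × K × b) b ℝ`, `Hv((k, l, a′), ·) = (J′_kJ_l − T′_kT_l)(a′, ·)`
— `h`-free. OURS (typing). [folklore] -/
def Hv (T J : K → Matrix P b ℝ) (T' J' : K → Matrix b P ℝ) : Matrix (K × K × b) b ℝ :=
  Matrix.of fun q c => (J' q.1 * J q.2.1 - T' q.1 * T q.2.1) q.2.2 c

/-- the coefficient of `Dv₂`: `LmD : Matrix b (K × P) ℝ`, `LmD(a, (l, p)) = Σ_k (T′_kΘ_k + J′_kΘ_l)(a, p)`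
(first differences of `h` times `h`-free entries). OURS (typing). [folklore] -/
def LmD (sp : P → E) (tb : K → P → E) (T' J' : K → Matrix b P ℝ) (h : E → ℝ) : Matrix b (K × P) ℝ :=
  Matrix.of fun a q => (∑ k, (T' k * ThE sp (tb k) h + J' k * ThE sp (tb q.1) h)) a q.2

/-- the coefficient of `Hv`: `LmH : Matrix b (K × K × b) ℝ`, `LmH(a, (k, l, a′)) = [a′ = a]·θ_l(xb a)`
(first differences of `h`). OURS (typing). [folklore] -/
def LmH (xb : b → E) (θs : K → E → ℝ) : Matrix b (K × K × b) ℝ :=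
  Matrix.of fun a q => if q.2.2 = a then θs q.2.1 (xb a) else 0

/-- the remainder `Lm₀ = Σ_k Σ_l T′_k·Θ_k(θ_l)·T_l` (SECOND differences of `h` times `h`-free entries).
OURS (typing). [folklore] -/
def Lm₀ (sp : P → E) (tb : K → P → E) (θs : K → E → ℝ) (T : K → Matrix P b ℝ) (T' : K → Matrix b P ℝ) :
    Matrix b b ℝ :=
  ∑ k, ∑ l, T' k * ThE sp (tb k) (θs l) * T l

omit [Fintype b] [DecidableEq b] in
/-- `LmD·Dv₂ = Σ_kΣ_l (T′_kΘ_k + J′_kΘ_l)·∂_l`. [folklore] -/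
theorem LmD_mul_Dv₂ (sp : P → E) (tb : K → P → E) (T J : K → Matrix P b ℝ) (T' J' : K → Matrix b P ℝ)
    (h : E → ℝ) :
    LmD sp tb T' J' h * Dv₂ T J =
      ∑ k, ∑ l, (T' k * ThE sp (tb k) h + J' k * ThE sp (tb l) h) * (T l - J l) := by
  have key : LmD sp tb T' J' h * Dv₂ T J =
      ∑ l, (∑ k, (T' k * ThE sp (tb k) h + J' k * ThE sp (tb l) h)) * (T l - J l) := by
    ext a c
    rw [Matrix.mul_apply, Fintype.sum_prod_type, Matrix.sum_apply]
    refine Finset.sum_congr rfl fun l _ => ?_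
    rw [Matrix.mul_apply]
    rfl
  rw [key]
  simp_rw [Matrix.sum_mul]
  exact Finset.sum_comm

omit [DecidableEq P] in
/-- `LmH·Hv = Σ_kΣ_l diagonal (θ_l ∘ xb)·H_kl`. [folklore] -/
theorem LmH_mul_Hv (xb : b → E) (θs : K → E → ℝ) (T J : K → Matrix P b ℝ) (T' J' : K → Matrix b P ℝ) :
    LmH xb θs * Hv T J T' J' = ∑ k, ∑ l, Matrix.diagonal (θs l ∘ xb) * (J' k * J l - T' k * T l) := by
  ext a c
  rw [Matrix.mul_apply, Fintype.sum_prod_type, Matrix.sum_apply]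
  refine Finset.sum_congr rfl fun k _ => ?_
  rw [Fintype.sum_prod_type, Matrix.sum_apply]
  refine Finset.sum_congr rfl fun l _ => ?_
  simp only [LmH, Hv, Matrix.of_apply, Matrix.diagonal_mul, Function.comp_apply, ite_mul, zero_mul]
  rw [Finset.sum_ite_eq', if_pos (Finset.mem_univ _)]

/-- **THE `hΛ` SHAPE FOR A SUM OF PAIRS**: for every term `W` carried by `(xb, xb)` (position-diagonal:
`𝔇(W) = 0`) and every family of pulled-back differences `θ` with `hθ`,
`𝔇(D′D + W) = [LmD ∣ LmH]·[Dv₂ ; Hv] + Lm₀` — literally `Lm₁·Dv + Lm₀` with the `h`-FREE stacked derivative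
`Dv = fromRows Dv₂ Hv` on the carrier `(K × P) ⊕ (K × K × b)`, a first-difference coefficient
`Lm₁ = fromCols LmD LmH` and a second-difference remainder `Lm₀`.  Exact; every `h`; every dimension; every
entry table with the stated supports. [folklore] -/
theorem hΛ_shape {θs : K → E → ℝ} {h : E → ℝ} (hT : ∀ k, IsCarried (tb k) xb (T k))
    (hJ : ∀ k, IsCarried sp xb (J k)) (hT' : ∀ k, IsCarried xb (tb k) (T' k))
    (hJ' : ∀ k, IsCarried xb sp (J' k)) (hθ : ∀ l p, θs l (sp p) = h (tb l p) - h (sp p))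
    {W : Matrix b b ℝ} (hW : IsCarried xb xb W) :
    tdef (Matrix.diagonal (h ∘ xb)) (Matrix.diagonal (h ∘ xb)) ((∑ k, (T' k - J' k)) * (∑ l, (T l - J l)) + W)
        ((∑ k, (T' k - J' k)) * (∑ l, (T l - J l)) + W) =
      Matrix.fromCols (LmD sp tb T' J' h) (LmH xb θs) * Matrix.fromRows (Dv₂ T J) (Hv T J T' J') +
        Lm₀ sp tb θs T T' := by
  rw [tdef_add, hW.tdef_eq_zero, add_zero, Matrix.fromCols_mul_fromRows, LmD_mul_Dv₂, LmH_mul_Hv,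
    tdef_pairs_mul_exchanged hT hJ hT' hJ' hθ]
  rfl

/-- the same with an ARBITRARY additional term `N` (the cross-position parts of a curvature perturbation):
its defect rides in the remainder as a named summand, `𝔇(D′D + W + N) = Lm₁·Dv + (Lm₀ + 𝔇(N))`. [folklore] -/
theorem hΛ_shape' {θs : K → E → ℝ} {h : E → ℝ} (hT : ∀ k, IsCarried (tb k) xb (T k))
    (hJ : ∀ k, IsCarried sp xb (J k)) (hT' : ∀ k, IsCarried xb (tb k) (T' k))
    (hJ' : ∀ k, IsCarried xb sp (J' k)) (hθ : ∀ l p, θs l (sp p) = h (tb l p) - h (sp p))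
    {W : Matrix b b ℝ} (hW : IsCarried xb xb W) (N : Matrix b b ℝ) :
    tdef (Matrix.diagonal (h ∘ xb)) (Matrix.diagonal (h ∘ xb))
        ((∑ k, (T' k - J' k)) * (∑ l, (T l - J l)) + W + N) ((∑ k, (T' k - J' k)) * (∑ l, (T l - J l)) + W + N) =
      Matrix.fromCols (LmD sp tb T' J' h) (LmH xb θs) * Matrix.fromRows (Dv₂ T J) (Hv T J T' J') +
        (Lm₀ sp tb θs T T' + tdef (Matrix.diagonal (h ∘ xb)) (Matrix.diagonal (h ∘ xb)) N N) := by
  rw [tdef_add, hΛ_shape hT hJ hT' hJ' hθ hW, add_assoc]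

/-! ### §4b Carried perturbation parts ride in `Dv` with first-difference coefficients -/

variable {I : Type*} [Fintype I] {τ : I → b → E} {N : I → Matrix b b ℝ}

/-- the stacked perturbation parts `Nv : Matrix (I × b) b ℝ`, `Nv((j, a′), ·) = N_j(a′, ·)` — `h`-free.
OURS (typing). [folklore] -/
def Nv (N : I → Matrix b b ℝ) : Matrix (I × b) b ℝ := Matrix.of fun q c => N q.1 q.2 c

/-- the coefficient of `Nv`: `LmN(a, (j, a′)) = −[a′ = a]·(h (τ_j a) − h (xb a))` (first differences of `h`
over the hop of part `j`). OURS (typing). [folklore] -/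
def LmN (xb : b → E) (τ : I → b → E) (h : E → ℝ) : Matrix b (I × b) ℝ :=
  Matrix.of fun a q => if q.2 = a then -(h (τ q.1 a) - h (xb a)) else 0

omit [Fintype P] [DecidableEq P] [Fintype K] in
/-- `LmN·Nv = −Σ_j diagonal (h ∘ τ_j − h ∘ xb)·N_j`. [folklore] -/
theorem LmN_mul_Nv (xb : b → E) (τ : I → b → E) (h : E → ℝ) (N : I → Matrix b b ℝ) :
    LmN xb τ h * Nv N = -∑ j, Matrix.diagonal (fun a => h (τ j a) - h (xb a)) * N j := by
  ext a c
  rw [Matrix.mul_apply, Fintype.sum_prod_type, Matrix.neg_apply, Matrix.sum_apply, ← Finset.sum_neg_distrib]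
  refine Finset.sum_congr rfl fun j _ => ?_
  simp only [LmN, Nv, Matrix.of_apply, Matrix.diagonal_mul, ite_mul, zero_mul, neg_mul]
  rw [Finset.sum_ite_eq', if_pos (Finset.mem_univ _)]

/-- **THE `hΛ` SHAPE WITH CARRIED PERTURBATION PARTS**: if the additional term is a finite sum `Σ_j N_j` of
parts carried by `(τ_j, xb)` (every finite-range `h`-free perturbation of `D′D` on a lattice decomposes so, by
relative position), then `𝔇(D′D + W + Σ_j N_j) = [LmD ∣ LmH ∣ LmN]·[Dv₂ ; Hv ; Nv] + Lm₀` — still literally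
`Lm₁·Dv + Lm₀` with `h`-free `Dv`, first-difference `Lm₁`, second-difference `Lm₀`; the perturbation contributes
the `h`-free rows `N_j` (controlled by the size of its entries, NOT by gradient bounds — see the header).
[folklore] -/
theorem hΛ_shape_parts {θs : K → E → ℝ} {h : E → ℝ} (hT : ∀ k, IsCarried (tb k) xb (T k))
    (hJ : ∀ k, IsCarried sp xb (J k)) (hT' : ∀ k, IsCarried xb (tb k) (T' k))
    (hJ' : ∀ k, IsCarried xb sp (J' k)) (hθ : ∀ l p, θs l (sp p) = h (tb l p) - h (sp p))
    {W : Matrix b b ℝ} (hW : IsCarried xb xb W) (hN : ∀ j, IsCarried (τ j) xb (N j)) :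
    tdef (Matrix.diagonal (h ∘ xb)) (Matrix.diagonal (h ∘ xb))
        ((∑ k, (T' k - J' k)) * (∑ l, (T l - J l)) + W + ∑ j, N j)
        ((∑ k, (T' k - J' k)) * (∑ l, (T l - J l)) + W + ∑ j, N j) =
      Matrix.fromCols (Matrix.fromCols (LmD sp tb T' J' h) (LmH xb θs)) (LmN xb τ h) *
          Matrix.fromRows (Matrix.fromRows (Dv₂ T J) (Hv T J T' J')) (Nv N) +
        Lm₀ sp tb θs T T' := by
  rw [tdef_add, hΛ_shape hT hJ hT' hJ' hθ hW, tdef_parts hN,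
    Matrix.fromCols_mul_fromRows (Matrix.fromCols (LmD sp tb T' J' h) (LmH xb θs)), LmN_mul_Nv]
  abel

end Pairs

/-! ## §5 One `Dv` for `hΛ` and `hM`: zero-padded coefficients on the sum carrier -/

section Shared

variable {m n t₁ t₂ : Type*} [Fintype t₁] [Fintype t₂]

/-- **SHARED CARRIER**: two one-sided forms `X = L₁·D₁ + R₁`, `Y = L₂·D₂ + R₂` with different derivative
blocks are one-sided forms over the SAME stacked derivative `fromRows D₁ D₂`, the coefficients padded by zero
blocks (the `CutModel` fields `hΛ` and `hM` share one `Dv : Matrix t b ℝ`). [folklore] -/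
theorem shared_carrier {X Y : Matrix m n ℝ} {L₁ : Matrix m t₁ ℝ} {D₁ : Matrix t₁ n ℝ} {L₂ : Matrix m t₂ ℝ}
    {D₂ : Matrix t₂ n ℝ} {R₁ R₂ : Matrix m n ℝ} (hX : X = L₁ * D₁ + R₁) (hY : Y = L₂ * D₂ + R₂) :
    X = Matrix.fromCols L₁ (0 : Matrix m t₂ ℝ) * Matrix.fromRows D₁ D₂ + R₁ ∧
      Y = Matrix.fromCols (0 : Matrix m t₁ ℝ) L₂ * Matrix.fromRows D₁ D₂ + R₂ := by
  rw [Matrix.fromCols_mul_fromRows, Matrix.fromCols_mul_fromRows, Matrix.zero_mul, Matrix.zero_mul, add_zero,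
    zero_add]
  exact ⟨hX, hY⟩

end Shared

/-! ## §6 One pair: the remainder `Am₀` of the `hA` shape, exchanged -/

section OnePair

variable {E s b : Type*} [Fintype s] [Fintype b] [DecidableEq s] [DecidableEq b]
variable {xs : s → E} {sb tb : b → E} {T J : Matrix b s ℝ} {T' J' : Matrix s b ℝ} {θ h : E → ℝ}

/-- **`Am₀` EXCHANGED** (the single-pair case of `cross_exchange`, in the two-part notation of
`B9SectCLatticeCalc` §§2–3): under `hθ : θ (sb c) = h (tb c) − h (sb c)`,
`J′Θ_hJ − T′Θ_hT = diagonal (θ ∘ xs)·(J′J − T′T) + T′·Θ_θ·T` — the remainder of `hA_shape` is a FIRST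
difference times the `h`-free table `J′J − T′T` (zero for a unitary, weight-matched pair away from boundary
deletions) plus SECOND differences `Θ_θ` times `h`-free tables.  This is the precise form of the remark in the
header §3 of `B9SectCLatticeCalc` ("second-order smallness of `Am₀` is not a consequence of the supports").
[folklore] -/
theorem am₀_exchange (hT' : IsCarried xs tb T') (hJ' : IsCarried xs sb J') (hθ : ∀ c, θ (sb c) = h (tb c) - h (sb c)) :
    J' * ThE sb tb h * J - T' * ThE sb tb h * T =
      Matrix.diagonal (θ ∘ xs) * (J' * J - T' * T) + T' * ThE sb tb θ * T :=
  cross_exchange (K := Unit) (tb := fun _ => tb) (T := fun _ => T) (J := fun _ => J) (T' := fun _ => T')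
    (J' := fun _ => J') (θs := fun _ => θ) (k := ()) (l := ()) hT' hJ' hθ

/-- **THE `hA` SHAPE, EXCHANGED**: `𝔇(∂*∂ + W) = (J′Θ_h + T′Θ_h)·∂ + diagonal (θ ∘ xs)·(J′J − T′T) + T′Θ_θT`.
[folklore] -/
theorem hA_shape_exchanged (hT : IsCarried tb xs T) (hJ : IsCarried sb xs J) (hT' : IsCarried xs tb T')
    (hJ' : IsCarried xs sb J') (hθ : ∀ c, θ (sb c) = h (tb c) - h (sb c)) {W : Matrix s s ℝ}
    (hW : IsCarried xs xs W) :
    tdef (Matrix.diagonal (h ∘ xs)) (Matrix.diagonal (h ∘ xs)) ((T' - J') * (T - J) + W) ((T' - J') * (T - J) + W) =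
      (J' * ThE sb tb h + T' * ThE sb tb h) * (T - J) + Matrix.diagonal (θ ∘ xs) * (J' * J - T' * T) +
        T' * ThE sb tb θ * T := by
  rw [hA_shape hT hJ hT' hJ' hW, am₀_exchange hT' hJ' hθ, add_assoc]

end OnePair

/-! ## §7 Sanity instances: the toy line (`Ξ_h` exchanged) and one plaquette in `d = 2` -/

section ToyLine

open B9SectCDiffCutModelToy4 (ι Sh Sh_apply fd fd_eq Th Xi Xi_eq)
open B9SectCLatticeCalc (nxt nxt_eq_of_succ ThE_toy)

variable {n B : ℕ}

/-- on the toy line of `…Toy4` (`∂ = S − 1`, `∂* = Sᵀ − 1`, one direction, `θ = fd h`): Toy4's second-order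
remainder `Ξ_h = Θ_h − SᵀΘ_hS` EXCHANGED — `Ξ_h = diagonal (fd h)·(1 − SᵀS) + Sᵀ·Θ_(fd h)·S`: a first
difference at the sites WITHOUT predecessor (`1 − SᵀS`, the boundary defect of unitarity) plus conjugated
second differences `Θ_(fd h) = diagonal (fd (fd h))`. [folklore] -/
theorem Xi_exchange (h : Fin n × Fin B → ℝ) :
    Xi h = Matrix.diagonal (fd h) * (1 - (Sh n B).transpose * Sh n B) + (Sh n B).transpose * Th (fd h) * Sh n B := by
  have hT' : IsCarried id nxt (Sh n B).transpose := by
    intro v a hva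
    rw [Matrix.transpose_apply, Sh_apply] at hva
    by_cases hy : ι v = ι a + 1
    · exact (nxt_eq_of_succ hy).symm
    · exact absurd (if_neg hy) hva
  have hθ : ∀ c : Fin n × Fin B, fd h (id c) = h (nxt c) - h (id c) := by
    intro c
    have e := congrFun (congrArg Matrix.diag (ThE_toy h)) c
    simp only [ThE, Th, Matrix.diag_diagonal] at e
    exact e.symm
  have key := am₀_exchange (T := Sh n B) (J := (1 : Matrix (Fin n × Fin B) (Fin n × Fin B) ℝ)) hT'
    (isCarried_diagonal id fun _ => (1 : ℝ)) hθ
  rw [ThE_toy, ThE_toy, Matrix.diagonal_one] at key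
  simp only [Matrix.one_mul, Matrix.mul_one, Function.comp_id] at key
  rw [← Xi_eq] at key
  exact key

end ToyLine

section Plaquette

/-! ### One plaquette in `d = 2` (non-vacuity with two pairs, distinct target positions, arbitrary transporter
entries).  Positions `E = ℤ × ℤ`; the plaquette `P = Unit` based at `0`; its four bonds `b = Fin 4`:
`0 ↦ (0, e₀)`, `1 ↦ (0, e₁)`, `2 ↦ (e₀, e₁)`, `3 ↦ (e₁, e₀)` (base point, direction), positions `plaqX`;
pairs `K = Fin 2`: pair `0` = "`∇₀A₁`" (target bond `2` at `e₀` with transporter entry `r₀`, source bond `1`),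
pair `1` = "`−∇₁A₀`" (target bond `3` at `e₁` with entry `−r₁`, source bond `0`); `D′ = Dᵀ`. -/

/-- the two unit vectors of `ℤ × ℤ`. OURS (typing). [folklore] -/
def plaqE : Fin 2 → ℤ × ℤ := ![(1, 0), (0, 1)]

/-- positions of the four bonds of the plaquette based at `0`. OURS (typing). [folklore] -/
def plaqX : Fin 4 → ℤ × ℤ := ![0, 0, (1, 0), (0, 1)]

/-- base position of the plaquette. OURS (typing). [folklore] -/
def plaqS : Unit → ℤ × ℤ := fun _ => 0

/-- target position of pair `k`: `e_k`. OURS (typing). [folklore] -/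
def plaqTb : Fin 2 → Unit → ℤ × ℤ := fun k _ => plaqE k

/-- target parts: pair `0` reads bond `2` with entry `r₀`, pair `1` reads bond `3` with entry `−r₁`
(`r₀, r₁` = arbitrary transporter entries). OURS (typing). [folklore] -/
def plaqT (r₀ r₁ : ℝ) : Fin 2 → Matrix Unit (Fin 4) ℝ :=
  ![Matrix.of fun _ c => if c = 2 then r₀ else 0, Matrix.of fun _ c => if c = 3 then -r₁ else 0]

/-- source parts: pair `0` reads bond `1` (entry `1`), pair `1` reads bond `0` (entry `−1`). OURS (typing).
[folklore] -/
def plaqJ : Fin 2 → Matrix Unit (Fin 4) ℝ :=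
  ![Matrix.of fun _ c => if c = 1 then 1 else 0, Matrix.of fun _ c => if c = 0 then -1 else 0]

/-- the pulled-back differences `θ_k(x) = h(x + e_k) − h(x)`. OURS (typing). [folklore] -/
def plaqθ (h : ℤ × ℤ → ℝ) : Fin 2 → ℤ × ℤ → ℝ := fun k x => h (x + plaqE k) - h x

/-- [folklore] -/
theorem plaq_hT (r₀ r₁ : ℝ) : ∀ k, IsCarried (plaqTb k) plaqX (plaqT r₀ r₁ k) := by
  intro k p c hne
  fin_cases k <;> fin_cases c <;> simp [plaqT, plaqTb, plaqX, plaqE] at hne ⊢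

/-- [folklore] -/
theorem plaq_hJ : ∀ k, IsCarried plaqS plaqX (plaqJ k) := by
  intro k p c hne
  fin_cases k <;> fin_cases c <;> simp [plaqJ, plaqS, plaqX] at hne ⊢

/-- [folklore] -/
theorem plaq_hT' (r₀ r₁ : ℝ) : ∀ k, IsCarried plaqX (plaqTb k) (plaqT r₀ r₁ k).transpose :=
  fun k => (plaq_hT r₀ r₁ k).transpose

/-- [folklore] -/
theorem plaq_hJ' : ∀ k, IsCarried plaqX plaqS (plaqJ k).transpose := fun k => (plaq_hJ k).transpose

/-- the direction device holds: `θ_l(0) = h(e_l) − h(0)`. [folklore] -/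
theorem plaq_hθ (h : ℤ × ℤ → ℝ) : ∀ l p, plaqθ h l (plaqS p) = h (plaqTb l p) - h (plaqS p) := by
  intro l p
  simp only [plaqθ, plaqS, plaqTb, zero_add]

/-- the zero table is carried by any pair of maps. [folklore] -/
theorem isCarried_zero {E u v : Type*} (ρ : u → E) (κ : v → E) : IsCarried ρ κ (0 : Matrix u v ℝ) :=
  fun _ _ hne => absurd rfl hne

/-- **THE `hΛ` SHAPE ON ONE PLAQUETTE** (`W = 0`): `𝔇(DᵀD) = [LmD ∣ LmH]·[Dv₂ ; Hv] + Lm₀` for the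
two-pair curl row with arbitrary transporter entries `r₀, r₁` and every `h : ℤ × ℤ → ℝ` — the abstract
hypotheses of `hΛ_shape` are jointly satisfiable in a genuinely two-dimensional configuration (two pairs with
DIFFERENT target positions `e₀ ≠ e₁`, the situation located as the obstruction in `B9SectCLatticeCalc` §5).
[folklore] -/
theorem plaquette_hΛ (h : ℤ × ℤ → ℝ) (r₀ r₁ : ℝ) :
    tdef (Matrix.diagonal (h ∘ plaqX)) (Matrix.diagonal (h ∘ plaqX))
        ((∑ k, ((plaqT r₀ r₁ k).transpose - (plaqJ k).transpose)) * (∑ l, (plaqT r₀ r₁ l - plaqJ l)) + 0)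
        ((∑ k, ((plaqT r₀ r₁ k).transpose - (plaqJ k).transpose)) * (∑ l, (plaqT r₀ r₁ l - plaqJ l)) + 0) =
      Matrix.fromCols (LmD plaqS plaqTb (fun k => (plaqT r₀ r₁ k).transpose) (fun k => (plaqJ k).transpose) h)
          (LmH plaqX (plaqθ h)) *
        Matrix.fromRows (Dv₂ (plaqT r₀ r₁) plaqJ)
          (Hv (plaqT r₀ r₁) plaqJ (fun k => (plaqT r₀ r₁ k).transpose) fun k => (plaqJ k).transpose) +
        Lm₀ plaqS plaqTb (plaqθ h) (plaqT r₀ r₁) fun k => (plaqT r₀ r₁ k).transpose :=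
  hΛ_shape (T' := fun k => (plaqT r₀ r₁ k).transpose) (J' := fun k => (plaqJ k).transpose) (plaq_hT r₀ r₁)
    plaq_hJ (plaq_hT' r₀ r₁) plaq_hJ' (plaq_hθ h) (isCarried_zero plaqX plaqX)

/-- and the coefficient tables are NOT all trivial there: the pair-`0` target part reads bond `2` with the
transporter entry, `(plaqT r₀ r₁ 0) () 2 = r₀`. [folklore] -/
theorem plaqT_entry (r₀ r₁ : ℝ) : plaqT r₀ r₁ 0 () 2 = r₀ := by
  simp [plaqT]

end Plaquette

end

end Literature.MathematicalPhysics.QuantumFieldTheory.Balaban1983to89.B9SectCLatticeCurl
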